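import Literature.MathematicalPhysics.QuantumFieldTheory.Balaban1983to89.B9Eq333ProjectionCovariance

/-!
# `Balaban1983to89.B11Eq115GaugeIsometry` — T. Bałaban, *The variational problem and background fields in renormalization group method for
# lattice gauge theories*, Commun. Math. Phys. **102** (1985) 277–309 [Balaban1985Variational] (115) p. 294 with *Propagators for lattice gauge
# theories in a background field*, Commun. Math. Phys. **99** (1985) 389–434 [Balaban1985BackgroundPropagators] (3.28) p. 395, (3.3) p. 391:
# THE BANACH CARRIER OF THE CHART LETTERS, `max{|A|_{(−1)}, |∇^{U}A|_{(−2)}}` (`B11Eq115Space.Space115 … (nabla115 η U)`), IS GAUGE ISOMETRIC —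
# `R(u)` maps the space at the background `U` onto the space at `U^u` preserving the norm, because `∇^{U^u}R(u) = R(u)∇^{U}` and
# `|uXu⁻¹| = |X|` for unit-bounded `u`

statement-level skeleton of published theorems with citation tags; proofs where landed; nothing here is a claim about the Yang–Mills mass gap

PDF held: `paper:balaban1985-cmp99-background-propagators` p. 395 (text layer, read 2026-08-22); [Balaban1985Variational] (115) via the tree's
`B11Eq115Space` docstrings (quoted there verbatim).

THE PRINT.  [B11] (115) p. 294 (as typed in `B11Eq115Space`): the norm `max{|A₁|_{(−1)}, |∇A₁|_{(−2)}}` of the configurations `A₁`, `∇ = ∇^{U₀}` the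
covariant derivative (3.3) of [B9] at the background; [B9] p. 395 (3.28): *«U^u(x, x′) = u(x)U(x, x′)u⁻¹(x′), (R(u)U′)(x, x′) = R(u(x))U′(x, x′)»*,
*«R(u)A is linear in A»*; [B7] p. 24: *«their logarithms are unitarily equivalent»* (conjugation by unit-bounded `u` preserves the norm).

WHY THIS FILE (cell context).  The pub-balaban NE9 chain's chart theorems ((H2) `B9Eq3126H1Bound`, (K) `B9Eq3126H1BoundCLM`, (S′)
`Support/NE9CurChartUniformBall`) read the letters `H₁(U)`, `𝔊(U)` as continuous linear maps INTO `Space115 L η lev₀ lev₁ (nabla115 η U)` — a normed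
space whose norm is INDEXED BY THE BACKGROUND through `∇^{U}`.  To carry the chart from the small-field ball to its gauge orbit (print's class
(3.35)), the first step is that these carriers are identified isometrically along the orbit.  This file types `R(u)` on the `𝔸`-valued bond
functions and jets, proves `∇^{U^u} R(u) = R(u) ∇^{U}` for the reference spelling `B11Eq111FrakG.nabla115`, and packages `R(u)` as a LINEAR
ISOMETRY between the (115)-spaces at `U` and at `U^u` (and as an isometry of every weighted sup size `|·|_w` of `𝔸`-valued functions).

WHAT IS DEFINED AND PROVED (sorry-free; no `Prop` placeholder; no inequality of the papers).
* §1 **`gaugeA g`** (`R(u)` on `𝔸`-valued bond functions: `(R(u)A)(b) = u(b₋)A(b)u(b₋)⁻¹`, linear), **`gaugeJ g`** (the same on jets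
  `(b, ν) ↦ (∇A)(b, ν)`, acting at `b₋`); inverses; `toAlg_gaugeW_eq_gaugeA` (junction with `B9Eq328GaugeAction.gaugeW` on the Hilbert carrier).
* §2 **`nabla115_gaugeU`** — `∇^{U^u}(R(u)A) = R(u)(∇^{U}A)` for `nabla115 η U = covGrad η⁻¹ (adTransport U)` (every background, every `u`, no
  hypothesis; `B9Eq328GaugeAction.covDeriv_conj` componentwise).
* §3 **`norm_negSup_conj`** / `norm_negSup_gaugeA` / `norm_negSup_gaugeJ` — every weighted sup size `|·|_w` of `𝔸`-valued functions is invariant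
  under pointwise conjugation by units in `U1` (`B8Ineq132.norm_conjR`); **`gaugeNeg u hu`** = such a conjugation as a linear isometry equivalence of
  `NegSup w 𝔸` (any index set and family `u`; `R(u)` = the family `g ∘ base point`).
* §4 **`gauge115 g U V`** — `R(u)` from `Space115 … (nabla115 η U)` to `Space115 … (nabla115 η V)` (linear for ANY `U`, `V`); `gauge115_inv_apply`;
  **`norm_gauge115`** (`‖R(u)f‖ = ‖f‖` when `V = U^u` and `u(x) ∈ U1`); **`gauge115Isometry`** : `Space115 … (nabla115 η U) ≃ₗᵢ[ℂ]
  Space115 … (nabla115 η (gaugeU g U))` — THE (115)-CARRIER IS GAUGE ISOMETRIC.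
MODEL / DECLARED READINGS.  (M1) the tree's encodings verbatim (`B11Eq115Space.NegSup/JetSup/Space115`, `B11Eq111FrakG.nabla115`,
`B9Eq328GaugeAction.gaugeU/AdA`); (M2) DISPLAYED: `u(x) ∈ U1` (unit-bounded with unit-bounded inverse — print's `U(N)`) for the norm statements
only; (M3) NOT HERE: the conjugation of the CLM letters `H1CLM`/`frakGAt` and of the chart (successor item), any bound of the papers.
HONEST SCOPE.  [folklore] conjugation algebra + sup-norm bookkeeping on the cell's own typed carriers; no estimate of the papers; NOT summit progress
(cell pub-balaban: NE9 NOT PRINTED / NOT PROVED; «NE9 ⇐ the named binders»; spine PROVED 0/9; HONEST DEPENDENCY: continuum YM on T⁴ ⇐ BetaPertH ∧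
nine spine estimates (0/9 proved); BetaPertH ⇐ (D1) ∧ (D4) ∧ CAP+tail; G-an2-4 gates asym, D1 and NE2/3/4).  Unit `b2b-balaban-t4-ne9-formalise-leaf-03`
(NE9 crux-team leaf prover, gen 60), INTENT I-ne9leaf03-g60-1 file (G5); NEW file importing `B9Eq333ProjectionCovariance` only; modifies nothing.  Net
new unproved facts: 0.
-/

noncomputable section

open scoped BigOperators

namespace Literature.MathematicalPhysics.QuantumFieldTheory.Balaban1983to89.B11Eq115GaugeIsometry

open B9SectCLatticeCarrier (Bond bpos btgt)
open B4Sect5Torus (TSite)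
open B9Eq311L2Pairing (WL2)
open B9Eq33CovDerivVector (adTransport covGrad covGrad_eq_covDeriv_comp)
open B11Eq115Space (NegSup JetSup Space115 levWeight)
open B11Eq111FrakG (nabla115)
open B11Eq103H1Complex (BondL2K)
open B9Eq310HessianOperator (toAlg)
open B7Prop1Explicit (U1)
open B7Eq78Linearization (conjR)
open B8Ineq132 (norm_conjR)
open B9Eq328GaugeAction B9Eq330HessianCovariance B9Eq333ProjectionCovariance

variable {d : ℕ} {Pd : Fin d → ℕ} {𝔸 : Type*} [NormedRing 𝔸] [NormedAlgebra ℂ 𝔸]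

/-! ## §1 `R(u)` on the `𝔸`-valued bond functions and on their jets -/

/-- **`R(u)` on `𝔸`-valued bond functions**: `(R(u)A)(b) = u(b₋)A(b)u(b₋)⁻¹` — print's *«(R(u)U′)(x, x′) = R(u(x))U′(x, x′)»*, linear in `A`.
[cite: Balaban1985BackgroundPropagators, (3.28) p.395] -/
def gaugeA (g : TSite d Pd → 𝔸ˣ) : (Bond d Pd → 𝔸) →ₗ[ℂ] (Bond d Pd → 𝔸) :=
  LinearMap.pi fun b => AdA (g (bpos b)) ∘ₗ LinearMap.proj b

/-- Pointwise. [cite: Balaban1985BackgroundPropagators, (3.28) p.395] -/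
@[simp] theorem gaugeA_apply (g : TSite d Pd → 𝔸ˣ) (A : Bond d Pd → 𝔸) (b : Bond d Pd) : gaugeA g A b = AdA (g (bpos b)) (A b) := rfl

/-- **`R(u)` on the jets `(b, ν) ↦ (∇A)(b, ν)`**, acting at the base point `b₋` of the differentiating bond. [cite: Balaban1985BackgroundPropagators, (3.28) p.395, (3.3) p.391] -/
def gaugeJ (g : TSite d Pd → 𝔸ˣ) : (Bond d Pd × Fin d → 𝔸) →ₗ[ℂ] (Bond d Pd × Fin d → 𝔸) :=
  LinearMap.pi fun p => AdA (g (bpos p.1)) ∘ₗ LinearMap.proj p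

/-- Pointwise. [cite: Balaban1985BackgroundPropagators, (3.28) p.395] -/
@[simp] theorem gaugeJ_apply (g : TSite d Pd → 𝔸ˣ) (F : Bond d Pd × Fin d → 𝔸) (p : Bond d Pd × Fin d) :
    gaugeJ g F p = AdA (g (bpos p.1)) (F p) := rfl

/-- `R(u⁻¹)R(u) = 1` on bond functions. [cite: Balaban1985BackgroundPropagators, (3.28) p.395] -/
@[simp] theorem gaugeA_inv_apply (g : TSite d Pd → 𝔸ˣ) (A : Bond d Pd → 𝔸) : gaugeA g⁻¹ (gaugeA g A) = A := by
  funext b; simp only [gaugeA_apply, Pi.inv_apply, AdA_inv_apply]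

/-- `R(u)R(u⁻¹) = 1` on bond functions. [cite: Balaban1985BackgroundPropagators, (3.28) p.395] -/
@[simp] theorem gaugeA_apply_inv (g : TSite d Pd → 𝔸ˣ) (A : Bond d Pd → 𝔸) : gaugeA g (gaugeA g⁻¹ A) = A := by
  funext b; simp only [gaugeA_apply, Pi.inv_apply, AdA_apply_inv]

/-- JUNCTION with the Hilbert carrier: a `W`-valued bond function read in the algebra transforms by `gaugeA` — `Φ(R(u)f) = R(u)(Φf)` for
`B9Eq328GaugeAction.gaugeW` and `B9Eq310HessianOperator.toAlg`. [cite: Balaban1985Averaging, (18)–(19) p.21; Balaban1985BackgroundPropagators, (3.28) p.395] -/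
theorem toAlg_gaugeW_eq_gaugeA {W : Type*} [NormedAddCommGroup W] [InnerProductSpace ℂ W] (φ : W ≃ₗ[ℂ] 𝔸) {c₀ : ℝ} (g : TSite d Pd → 𝔸ˣ)
    (f : BondL2K ℂ d Pd c₀ W) : toAlg φ (gaugeW φ (fun b : Bond d Pd => g (bpos b)) f) = gaugeA g (toAlg φ f) := by
  rw [toAlg_gaugeW]; rfl

/-! ## §2 `∇^{U^u} R(u) = R(u) ∇^{U}` for the reference spelling of (115)'s derivative -/

/-- **THE COVARIANT GRADIENT OF (115) IS COVARIANT**: `∇^{U^u}(R(u)A) = R(u)(∇^{U}A)` for `nabla115 η U = covGrad η⁻¹ (adTransport U)` — every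
background, every gauge function, no hypothesis. [cite: Balaban1985BackgroundPropagators, (3.3) p.391, (3.28)–(3.31) p.395] -/
theorem nabla115_gaugeU (η : ℝ) (g : TSite d Pd → 𝔸ˣ) (U : Bond d Pd → 𝔸ˣ) (A : Bond d Pd → 𝔸) :
    nabla115 η (gaugeU g U) (gaugeA g A) = gaugeJ g (nabla115 η U A) := by
  funext p
  obtain ⟨b, ν⟩ := p
  rw [gaugeJ_apply]
  show covGrad ((η : ℂ)⁻¹) (adTransport (gaugeU g U)) (gaugeA g A) (b, ν) = AdA (g (bpos b)) (covGrad ((η : ℂ)⁻¹) (adTransport U) A (b, ν))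
  rw [covGrad_eq_covDeriv_comp, covGrad_eq_covDeriv_comp]
  exact covDeriv_conj _ _ _ (fun x => AdA (g x)) (fun x => AdA (g x)⁻¹) (fun x v => AdA_inv_apply (g x) v)
    (fun b v => adTransport_gaugeU g U b v) _ b

/-- As an equality of linear maps: `∇^{U^u} ∘ R(u) = R(u) ∘ ∇^{U}`. [cite: Balaban1985BackgroundPropagators, (3.31) p.395] -/
theorem nabla115_comp_gaugeA (η : ℝ) (g : TSite d Pd → 𝔸ˣ) (U : Bond d Pd → 𝔸ˣ) :
    nabla115 η (gaugeU g U) ∘ₗ gaugeA g = gaugeJ g ∘ₗ nabla115 η U :=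
  LinearMap.ext fun A => nabla115_gaugeU η g U A

/-! ## §3 Every weighted sup size of `𝔸`-valued functions is `R(u)`-invariant for unit-bounded `u` -/

section Sup

variable [NormOneClass 𝔸]

omit [NormedAlgebra ℂ 𝔸] in
/-- `|uXu⁻¹| = |X|` for `u ∈ U1` — `B9Eq328GaugeAction.AdA` read through `B8Ineq132.norm_conjR`. [cite: Balaban1985Averaging, p.24] -/
theorem norm_AdA [NormedAlgebra ℂ 𝔸] {u : 𝔸ˣ} (hu : u ∈ U1 𝔸) (X : 𝔸) : ‖AdA u X‖ = ‖X‖ := by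
  rw [AdA_eq_conjR, norm_conjR hu]

variable {ι : Type*} [Fintype ι] {w : ι → ℝ} [Fact (∀ i, 0 < w i)]

/-- **A pointwise conjugation by unit-bounded units preserves EVERY weighted sup size `|·|_w`** (the profiles `w(i)‖f(i)‖` coincide).
[cite: Balaban1985Variational, p.286; Balaban1985Averaging, p.24] -/
theorem norm_negSup_conj (u : ι → 𝔸ˣ) (hu : ∀ i, u i ∈ U1 𝔸) (F : ι → 𝔸) :
    ‖(NegSup.equiv w 𝔸).symm (fun i => AdA (u i) (F i))‖ = ‖(NegSup.equiv w 𝔸).symm F‖ := by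
  rw [NegSup.norm_def, NegSup.norm_def]
  congr 1
  funext i
  rw [NegSup.profile_apply, NegSup.profile_apply, Equiv.apply_symm_apply, Equiv.apply_symm_apply, norm_AdA (hu i)]

/-- `|R(u)A|_w = |A|_w` for bond functions. [cite: Balaban1985Variational, p.286; Balaban1985BackgroundPropagators, (3.28) p.395] -/
theorem norm_negSup_gaugeA {w : Bond d Pd → ℝ} [Fact (∀ b, 0 < w b)] {g : TSite d Pd → 𝔸ˣ} (hg : ∀ x, g x ∈ U1 𝔸) (A : Bond d Pd → 𝔸) :
    ‖(NegSup.equiv w 𝔸).symm (gaugeA g A)‖ = ‖(NegSup.equiv w 𝔸).symm A‖ :=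
  norm_negSup_conj (fun b : Bond d Pd => g (bpos b)) (fun _ => hg _) A

/-- `|R(u)∇A|_w = |∇A|_w` for jets. [cite: Balaban1985Variational, p.286; Balaban1985BackgroundPropagators, (3.28) p.395] -/
theorem norm_negSup_gaugeJ {w : Bond d Pd × Fin d → ℝ} [Fact (∀ p, 0 < w p)] {g : TSite d Pd → 𝔸ˣ} (hg : ∀ x, g x ∈ U1 𝔸)
    (F : Bond d Pd × Fin d → 𝔸) : ‖(NegSup.equiv w 𝔸).symm (gaugeJ g F)‖ = ‖(NegSup.equiv w 𝔸).symm F‖ :=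
  norm_negSup_conj (fun p : Bond d Pd × Fin d => g (bpos p.1)) (fun _ => hg _) F

/-- **A POINTWISE CONJUGATION BY UNIT-BOUNDED UNITS AS A LINEAR ISOMETRY EQUIVALENCE OF THE SIZE `|·|_w`** (e.g. `R(u)` on
`B11Eq115Space.NegSize L η lev n 𝔸` — the domains `|·|_{(−3)}` of `𝔊` and `|·|_{(−0)}` of `H₁`; family `u = g ∘ base point`).
[cite: Balaban1985Variational, p.286, (98) p.293; Balaban1985BackgroundPropagators, (3.28) p.395] -/
def gaugeNeg (u : ι → 𝔸ˣ) (hu : ∀ i, u i ∈ U1 𝔸) : NegSup w 𝔸 ≃ₗᵢ[ℂ] NegSup w 𝔸 where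
  toFun f := (NegSup.equiv w 𝔸).symm fun i => AdA (u i) (NegSup.equiv w 𝔸 f i)
  invFun f := (NegSup.equiv w 𝔸).symm fun i => AdA (u i)⁻¹ (NegSup.equiv w 𝔸 f i)
  map_add' f f' := by
    apply (NegSup.equiv w 𝔸).injective
    funext i
    simp only [Equiv.apply_symm_apply]
    exact map_add (AdA (u i)) _ _
  map_smul' c f := by
    apply (NegSup.equiv w 𝔸).injective
    funext i
    simp only [Equiv.apply_symm_apply, RingHom.id_apply]
    exact map_smul (AdA (u i)) _ _
  left_inv f := by
    apply (NegSup.equiv w 𝔸).injective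
    funext i
    simp only [Equiv.apply_symm_apply, AdA_inv_apply]
  right_inv f := by
    apply (NegSup.equiv w 𝔸).injective
    funext i
    simp only [Equiv.apply_symm_apply, AdA_apply_inv]
  norm_map' f := by
    show ‖(NegSup.equiv w 𝔸).symm fun i => AdA (u i) (NegSup.equiv w 𝔸 f i)‖ = ‖f‖
    rw [norm_negSup_conj u hu]
    rfl

/-- Pointwise form of `gaugeNeg`. [cite: Balaban1985BackgroundPropagators, (3.28) p.395] -/
theorem gaugeNeg_apply (u : ι → 𝔸ˣ) (hu : ∀ i, u i ∈ U1 𝔸) (f : NegSup w 𝔸) (i : ι) :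
    NegSup.equiv w 𝔸 (gaugeNeg (w := w) u hu f) i = AdA (u i) (NegSup.equiv w 𝔸 f i) := rfl

/-- As a function: `gaugeNeg u hu f = (i ↦ u(i) f(i) u(i)⁻¹)`. [cite: Balaban1985BackgroundPropagators, (3.28) p.395] -/
theorem equiv_gaugeNeg (u : ι → 𝔸ˣ) (hu : ∀ i, u i ∈ U1 𝔸) (f : NegSup w 𝔸) :
    NegSup.equiv w 𝔸 (gaugeNeg (w := w) u hu f) = fun i => AdA (u i) (NegSup.equiv w 𝔸 f i) := rfl

end Sup

/-! ## §4 The (115)-carrier is gauge isometric -/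

section Space

variable {L η : ℝ} {lev₀ : Bond d Pd → ℕ} {lev₁ : Bond d Pd × Fin d → ℕ} (g : TSite d Pd → 𝔸ˣ) (U V : Bond d Pd → 𝔸ˣ)

/-- **`R(u)` FROM THE SPACE (115) AT `U` TO THE SPACE (115) AT `V`** (pointwise `u(b₋)A(b)u(b₋)⁻¹`; linear for any two backgrounds — the norm
statement below needs `V = U^u`). [cite: Balaban1985Variational, (115) p.294; Balaban1985BackgroundPropagators, (3.28) p.395] -/
def gauge115 : Space115 (𝕜 := ℂ) L η lev₀ lev₁ (nabla115 η U) →ₗ[ℂ] Space115 (𝕜 := ℂ) L η lev₀ lev₁ (nabla115 η V) where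
  toFun f := (JetSup.equiv _ _ _).symm (gaugeA g (JetSup.equiv _ _ _ f))
  map_add' f f' := by
    apply (JetSup.equiv (levWeight L η lev₀ 1) (levWeight L η lev₁ 2) (nabla115 η V)).injective
    simp only [Equiv.apply_symm_apply, JetSup.equiv_add]
    exact map_add (gaugeA g) _ _
  map_smul' c f := by
    apply (JetSup.equiv (levWeight L η lev₀ 1) (levWeight L η lev₁ 2) (nabla115 η V)).injective
    simp only [Equiv.apply_symm_apply, JetSup.equiv_smul, RingHom.id_apply]
    exact map_smul (gaugeA g) _ _

/-- The function underlying `R(u)f` is `gaugeA g` of the function underlying `f`. [cite: Balaban1985BackgroundPropagators, (3.28) p.395] -/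
theorem equiv_gauge115 (f : Space115 (𝕜 := ℂ) L η lev₀ lev₁ (nabla115 η U)) :
    JetSup.equiv _ _ _ (gauge115 (lev₀ := lev₀) (lev₁ := lev₁) g U V f) = gaugeA g (JetSup.equiv _ _ _ f) := rfl

/-- `R(u⁻¹)R(u) = 1` between the (115)-spaces (any backgrounds). [cite: Balaban1985BackgroundPropagators, (3.28) p.395] -/
@[simp] theorem gauge115_inv_apply (f : Space115 (𝕜 := ℂ) L η lev₀ lev₁ (nabla115 η U)) :
    gauge115 (lev₀ := lev₀) (lev₁ := lev₁) g⁻¹ V U (gauge115 g U V f) = f := by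
  apply (JetSup.equiv (levWeight L η lev₀ 1) (levWeight L η lev₁ 2) (nabla115 η U)).injective
  rw [equiv_gauge115, equiv_gauge115, gaugeA_inv_apply]

/-- `R(u)R(u⁻¹) = 1` between the (115)-spaces (any backgrounds). [cite: Balaban1985BackgroundPropagators, (3.28) p.395] -/
@[simp] theorem gauge115_apply_inv (f : Space115 (𝕜 := ℂ) L η lev₀ lev₁ (nabla115 η V)) :
    gauge115 (lev₀ := lev₀) (lev₁ := lev₁) g U V (gauge115 g⁻¹ V U f) = f := by
  apply (JetSup.equiv (levWeight L η lev₀ 1) (levWeight L η lev₁ 2) (nabla115 η V)).injective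
  rw [equiv_gauge115, equiv_gauge115, gaugeA_apply_inv]

variable {g U V} [NormOneClass 𝔸] [Fact (0 < L)] [Fact (0 < η)]

/-- **`‖R(u)f‖₍₁₁₅₎ = ‖f‖₍₁₁₅₎` WHEN `V = U^u` AND `u(x) ∈ U1`**: the zeroth-order part by §3, the first-order part by §2 (`∇^{U^u}R(u)f = R(u)∇^U f`)
and §3. [cite: Balaban1985Variational, (115) p.294; Balaban1985BackgroundPropagators, (3.28)–(3.31) p.395] -/
theorem norm_gauge115 (hg : ∀ x, g x ∈ U1 𝔸) (hV : V = gaugeU g U) (f : Space115 (𝕜 := ℂ) L η lev₀ lev₁ (nabla115 η U)) :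
    ‖gauge115 (lev₀ := lev₀) (lev₁ := lev₁) g U V f‖ = ‖f‖ := by
  subst hV
  rw [JetSup.norm_def (𝕜 := ℂ) (w₀ := levWeight L η lev₀ 1) (w₁ := levWeight L η lev₁ 2) (D := nabla115 η (gaugeU g U)),
    JetSup.norm_def (𝕜 := ℂ) (w₀ := levWeight L η lev₀ 1) (w₁ := levWeight L η lev₁ 2) (D := nabla115 η U)]
  congr 1
  · show ‖(NegSup.equiv _ 𝔸).symm (JetSup.equiv _ _ _ (gauge115 g U (gaugeU g U) f))‖ = ‖(NegSup.equiv _ 𝔸).symm (JetSup.equiv _ _ _ f)‖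
    rw [equiv_gauge115, norm_negSup_gaugeA (w := levWeight L η lev₀ 1) hg]
  · show ‖(NegSup.equiv _ 𝔸).symm (nabla115 η (gaugeU g U) (JetSup.equiv _ _ _ (gauge115 g U (gaugeU g U) f)))‖ =
      ‖(NegSup.equiv _ 𝔸).symm (nabla115 η U (JetSup.equiv _ _ _ f))‖
    rw [equiv_gauge115, nabla115_gaugeU, norm_negSup_gaugeJ (w := levWeight L η lev₁ 2) hg]

/-- **THE (115)-CARRIER IS GAUGE ISOMETRIC**: `R(u)` is a linear isometry equivalence `Space115 … (∇^{U}) ≃ Space115 … (∇^{U^u})` for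
`u(x) ∈ U1`. [cite: Balaban1985Variational, (115) p.294; Balaban1985BackgroundPropagators, (3.28)–(3.31) p.395] -/
def gauge115Isometry (hg : ∀ x, g x ∈ U1 𝔸) (U : Bond d Pd → 𝔸ˣ) :
    Space115 (𝕜 := ℂ) L η lev₀ lev₁ (nabla115 η U) ≃ₗᵢ[ℂ] Space115 (𝕜 := ℂ) L η lev₀ lev₁ (nabla115 η (gaugeU g U)) where
  toLinearMap := gauge115 g U (gaugeU g U)
  invFun := gauge115 g⁻¹ (gaugeU g U) U
  left_inv f := gauge115_inv_apply g U (gaugeU g U) f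
  right_inv f := gauge115_apply_inv g U (gaugeU g U) f
  norm_map' f := norm_gauge115 hg rfl f

/-- Pointwise form of the isometry. [cite: Balaban1985BackgroundPropagators, (3.28) p.395] -/
theorem gauge115Isometry_apply (hg : ∀ x, g x ∈ U1 𝔸) (U : Bond d Pd → 𝔸ˣ) (f : Space115 (𝕜 := ℂ) L η lev₀ lev₁ (nabla115 η U)) :
    gauge115Isometry (lev₀ := lev₀) (lev₁ := lev₁) hg U f = gauge115 g U (gaugeU g U) f := rfl

end Space

end Literature.MathematicalPhysics.QuantumFieldTheory.Balaban1983to89.B11Eq115GaugeIsometry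

end
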